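import Summits.HubbardSuperconductivity.HubbardSuperconductivity.Theses.BalabanIR
import Literature.Probability.LatticeModels.BalabanStepOneFormat
import Summits.HubbardSuperconductivity.HubbardSuperconductivity.Theorems.BalabanIRBirGappedPhaseReductionRFormatSplit
import HarnessLib

/-!
# Line `format-pair` — skeleton for crux 4R `BalabanIR.BirGappedPhaseReductionR` (stmt-HubbardSuperconductivity-14846), lead c18 → c19

The crux-strategist's decomposition D2′ (`Cruxes/BirGappedPhaseReductionR/SPLIT-PROPOSAL.md`, s1, 2026-08-17) adopted as
the lead's line: the two registered stubs ARE the two children of the split over the typed Defs layer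
`Literature.Probability.LatticeModels.BalabanStepOne` (p148658, in the tree),

* `stub_formatEngine` = C1 `BirFormatEngine` (= 14845′: the engine restated over weights in Balaban's depth-one step-one
  format — Hubbard-free, crux-sized);
* `stub_formatMembershipTransfer` = C2 `BirFormatMembershipTransfer` (= 14846′: MEMBERSHIP ∧ TRANSFER about `hubbardTorus`
  alone — the two-regime constructive fermionic expansion, crux-sized),

and the composition `BirGappedPhaseReductionR_of` concludes the crux BY NAME; its proof is the structural glue
`Theorems.birGappedPhaseReductionR_of_formatPair` (LANDED: `Theorems/BalabanIRBirGappedPhaseReductionRFormatSplit.lean`, p160973) applied to the stubs: the typed antecedents `h2R`, `h3` of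
`BirGappedPhaseReductionR := BirComplexStableXYR → BirBdGPhaseCoercivity → BirGroundStateAverageLRO` are discarded and the
`β → ∞` endgame is the landed Theses-free bridge `dWaveGroundStateAverageLRO_of_frequently_thermal`.
Both stubs are crux-sized by the strategist's own audit (SPLIT-PROPOSAL §5) — this skeleton is the registry form of the split
(outcome `promote-stub`), not a claim that either child is a session task.

Lead c19 (2026-08-17): audit wave on both stubs → `stub-blocked: stmt-…-14845` (C1) / `stub-blocked: stmt-…-2079` (C2),
no typing defect found; supports landed for C1's class: the CALIBRATION of the format by the XY Gibbs weight —
`Literature/Probability/LatticeModels/BalabanStepOneFormat{Polymer,PolymerGas,XYBonds,XYAction,XYActivity,XYMembership}.lean`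
(`xyWeight_stepOneFormat : 0 ≤ κ → cL < 1/4 → ∃ K₀, ∀ K ≥ K₀, ∀ L' M, StepOneFormat K 14 1 cL κ L' M (xyWeight K)`) and
`Theorems/BalabanIRBirFormatEngineXY.lean` (`engineConclusion_xyWeight`: the calibration member satisfies `EngineConclusion`
for `K ≥ 128`, `4 ≤ L' ≤ M` even, = `birSliceXYOrderRP_proof` transported).  So C1 quantifies over an inhabited class and is a
strict strengthening of a proved theorem; neither stub shrank.
-/

set_option linter.dupNamespace false -- crux workfile namespace `Summit.<S>.<S>.Cruxes…` (D-0017 layout)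

noncomputable section

namespace Summit.HubbardSuperconductivity.HubbardSuperconductivity.Cruxes.BirGappedPhaseReductionR.Lines.FormatPair

open scoped BigOperators ComplexConjugate
open MeasureTheory Filter Literature.Probability.LatticeModels Literature.MathematicalPhysics.QuantumLattice
open Summit.HubbardSuperconductivity.HubbardSuperconductivity.Theses.BalabanIR
open Summit.HubbardSuperconductivity.HubbardSuperconductivity.Theorems

/-! ## Registered stubs -/

/-- **stub C1 (XL) — `BirFormatEngine`.** For every budget `B`, coercivity rate `c₀ > 0` and large-field rate `cL > 0` there
are thresholds `κ₀, K₀, L₀` such that every weight in `StepOneFormat K B c₀ cL κ` with `κ ≥ κ₀`, `K ≥ K₀`, on an even block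
torus `L₀ ≤ L' ≤ M`, has `Z ≠ 0` and slice order `≥ 1/2`.  Balaban's multiscale programme for COMPLEX quasi-local actions with
continuous symmetry from depth-one format (Balaban1995–1998 real; BFKT2017 complex without symmetry breaking): open. -/
theorem stub_formatEngine :
    ∀ (B c₀ cL : ℝ), 0 < c₀ → 0 < cL → ∃ κ₀ K₀ : ℝ, ∃ L₀ : ℕ, ∀ (κ K : ℝ), κ₀ ≤ κ → K₀ ≤ K → ∀ (L' M : ℕ) [NeZero L'] [NeZero M], L₀ ≤ L' → L' ≤ M → Even L' → Even M → ∀ ρ : (Literature.Probability.LatticeModels.TorusSite 2 L' × ZMod M → ℝ) → ℂ, Literature.Probability.LatticeModels.BalabanStepOne.StepOneFormat K B c₀ cL κ L' M ρ → Literature.Probability.LatticeModels.BalabanStepOne.EngineConclusion L' M ρ := by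
  sorry

/-- **stub C2 (XL) — `BirFormatMembershipTransfer`.** For some `δ ∈ (0,1/2)` and class data `(B, c₀, cL)`, every triple of
engine thresholds `(κ₀, K₀, L₀)` admits a weak-coupling window and `cP > 0` such that for every `U` in the window, eventually in
even `L`, frequently in `β`, some step-one-format weight at `κ ≥ κ₀`, `K ≥ K₀` on an even block torus `L₀ ≤ L' ≤ M` (intended: the
cyclic Trotter weight of the slaved block pair field of `hubbardTorus 2 L 1 U`) has the property that ITS engine conclusion implies
the canonical `(N_L, S^z = 0)`-sector thermal bound `cP·L⁴ ≤ Re tr(P_S e^{-βH} Δ_d†Δ_d)/tr(P_S e^{-βH})`.  The two-regime constructive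
expansion of the 2D Hubbard model below the BCS scale (WeakCouplingCeiling): open. -/
theorem stub_formatMembershipTransfer :
    ∃ δ ∈ Set.Ioo (0:ℝ) (1/2), ∃ (B c₀ cL : ℝ), 0 < c₀ ∧ 0 < cL ∧ ∀ (κ₀ K₀ : ℝ) (L₀ : ℕ), ∃ U₁ U₂ cP : ℝ, 0 < U₁ ∧ U₁ < U₂ ∧ 0 < cP ∧ ∀ U ∈ Set.Ioo U₁ U₂, ∃ L₁ : ℕ, ∀ (L : ℕ) [NeZero L], L₁ ≤ L → Even L → let N : ℕ := 2 * ⌊(1 - δ) * (L : ℝ) ^ 2 / 2⌋₊; let H := Literature.MathematicalPhysics.QuantumLattice.hubbardTorus 2 L 1 U; let S := Literature.MathematicalPhysics.QuantumLattice.szSector (Λ := Literature.MathematicalPhysics.QuantumLattice.FermionTorus 2 L) N 0; let PS := Literature.MathematicalPhysics.QuantumLattice.projMatrix (S.map (Literature.MathematicalPhysics.QuantumLattice.Fock.toEuclidean (ι := Literature.MathematicalPhysics.QuantumLattice.Orb (Literature.MathematicalPhysics.QuantumLattice.FermionTorus 2 L)) : Literature.MathematicalPhysics.QuantumLattice.Fock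 (Literature.MathematicalPhysics.QuantumLattice.Orb (Literature.MathematicalPhysics.QuantumLattice.FermionTorus 2 L)) →ₗ[ℂ] EuclideanSpace ℂ (Finset (Literature.MathematicalPhysics.QuantumLattice.Orb (Literature.MathematicalPhysics.QuantumLattice.FermionTorus 2 L))))); ∃ᶠ β : ℝ in Filter.atTop, ∃ (κ K : ℝ), κ₀ ≤ κ ∧ K₀ ≤ K ∧ ∃ (L' M : ℕ) (_ : NeZero L') (_ : NeZero M), L₀ ≤ L' ∧ L' ≤ M ∧ Even L' ∧ Even M ∧ ∃ ρ : (Literature.Probability.LatticeModels.TorusSite 2 L' × ZMod M → ℝ) → ℂ, Literature.Probability.LatticeModels.BalabanStepOne.StepOneFormat K B c₀ cL κ L' M ρ ∧ (Literature.Probability.LatticeModels.BalabanStepOne.EngineConclusion L' M ρ → cP * (L : ℝ) ^ 4 ≤ ((PS * Matrix.gibbsWeight β H * (Matrix.conjTranspose (Literature.MathematicalPhysics.QuantumLattice.pairField Literature.MathematicalPhysics.QuantumLattice.dWaveFormFactor L) * Literature.MathematicalPhysics.QuantumLattice.pairField Literature.MathematicalPhysics.QuantumLattice.dWaveFormFactor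 L)).trace / (PS * Matrix.gibbsWeight β H).trace).re) := by
  sorry

/-! ## Composition -/

/-- **The line closes the crux BY NAME modulo its two registered stubs** (the glue `birGappedPhaseReductionR_of_formatPair`
`Theorems.birGappedPhaseReductionR_of_formatPair`, p160973, applied to the stubs after unfolding the four route defs; `h2R`, `h3` discarded). -/
theorem BirGappedPhaseReductionR_of : BirGappedPhaseReductionR := by
  unfold BirGappedPhaseReductionR BirComplexStableXYR BirBdGPhaseCoercivity BirGroundStateAverageLRO
  exact birGappedPhaseReductionR_of_formatPair stub_formatEngine stub_formatMembershipTransfer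

end Summit.HubbardSuperconductivity.HubbardSuperconductivity.Cruxes.BirGappedPhaseReductionR.Lines.FormatPair

end
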